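import Literature.NumberTheory.Transcendental.SemistabilityInduction
import Literature.NumberTheory.Transcendental.PhilipponZeroEstimateStdProofs
import HarnessLib

/-!
# Transcendence and linear relations of 1-periods: discharge of `HuberWustholzOnePeriods`

Topic: `Literature/NumberTheory/Transcendental`. The named fact
`Literature.NumberTheory.Transcendental.HuberWustholzOnePeriods` of `OnePeriods.lean` — the
`ℚ̄`-linear independence of `1, 2πi, log α, ω₁, ω₂, η₁, η₂` for an elliptic curve over `ℚ̄`
without complex multiplication and an algebraic non-root of unity `α` (A. Huber, G. Wüstholz,
*Transcendence and linear relations of 1-periods*, Cambridge Tracts 227 (2022), the elliptic case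
of the dimension formula for period spaces of 1-motives; classically Wüstholz's analytic subgroup
theorem applied to `𝔾ₐ × 𝔾ₘ × G_E`, `G_E` the universal vectorial extension of `E`) — is PROVED:

* `HuberWustholzOnePeriods_holds : HuberWustholzOnePeriods` — the tree's reduction
  `HuberWustholzOnePeriods_of_philippon` (analytic subgroup theorem for `𝔾ₐ × 𝔾ₘ^β × P_κ` by
  the semistability induction of `SemistabilityInduction.lean`, Baker–Wüstholz's auxiliary
  construction, and the torsion dichotomy) applied to the now discharged zero estimate
  `philippon1986_std_holds`.

* `masser_ellipticPeriods_holds : masser_ellipticPeriods` — Masser 1975, Ch. II, Thm. II (for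
  `g₂, g₃` algebraic and `℘` without complex multiplication the six numbers
  `1, ω₁, ω₂, η₁, η₂, 2πi` are linearly independent over `ℚ̄`; the named fact of `OnePeriods.lean`):
  the tree's reduction `SemistabilityInduction.masser_of_philippon` (the same analytic subgroup
  theorem for `M_κ`, specialised to the periods through `masser_of_huberWustholz`) applied to
  `philippon1986_std_holds`. The proof in the tree is thus NOT Masser's original one (his
  transcendence measure for `ω₂/ω₁`, Coates 1971, and the three-variable auxiliary function with
  extrapolation on division points — of which Thm. I, Lemma 2.2, Lemma 2.4 and the transcendence
  of `ω₂/ω₁` are in the tree as `Masser*.lean`) but the Wüstholz / Baker–Wüstholz route.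

## References

* A. Huber, G. Wüstholz, *Transcendence and Linear Relations of 1-Periods*, Cambridge Tracts in
  Mathematics 227, CUP 2022, Thm. 14.7 / §17 (elliptic curves). [HuberWustholz2022]
* G. Wüstholz, *Algebraische Punkte auf analytischen Untergruppen algebraischer Gruppen*,
  Ann. of Math. 129 (1989), 501–517. [folklore]
* P. Philippon, *Lemmes de zéros dans les groupes algébriques commutatifs*, Bull. Soc. Math.
  France 114 (1986), 355–383, Thm. 2.1. [Philippon1986]
* D. W. Masser, *Elliptic Functions and Transcendence*, Lecture Notes in Math. 437, Springer 1975,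
  Ch. II, Thm. II (p. 16). [Masser1975]
* A. Baker, G. Wüstholz, *Logarithmic Forms and Diophantine Geometry*, New Math. Monographs 9,
  CUP 2007, Thm. 6.1 and Thm. 6.15. [BakerWustholz2007]
-/

noncomputable section

namespace Literature.NumberTheory.Transcendental

/-- **Huber–Wüstholz: `1, 2πi, log α, ω₁, ω₂, η₁, η₂` are `ℚ̄`-linearly independent** for an
elliptic curve over `ℚ̄` without complex multiplication and an algebraic non-root of unity `α`
with `e^w = α` — the named fact `HuberWustholzOnePeriods` holds.
[cite: HuberWustholz2022, Thm. 14.7, §17] -/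
theorem HuberWustholzOnePeriods_holds : HuberWustholzOnePeriods :=
  HuberWustholzOnePeriods_of_philippon philippon1986_std_holds

/-- **Masser 1975, Ch. II, Thm. II** — the named fact `masser_ellipticPeriods` holds: for a lattice
with algebraic invariants `g₂, g₃` and no complex multiplication, the six numbers
`1, ω₁, ω₂, η₁, η₂, 2πi` are linearly independent over `ℚ̄`. Obtained from the tree's reduction
`masser_of_philippon` (analytic subgroup theorem for `𝔾ₐ × 𝔾ₘ^β × P_κ` in Baker–Wüstholz's
semistable form, `SemistabilityInduction.lean`) and the discharged zero estimate
`philippon1986_std_holds`. [cite: Masser1975, Ch. II Thm. II (p. 16)]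
[cite: BakerWustholz2007, Thm. 6.15] [cite: Philippon1986, Thm. 2.1] -/
theorem masser_ellipticPeriods_holds : masser_ellipticPeriods :=
  masser_of_philippon philippon1986_std_holds

end Literature.NumberTheory.Transcendental

end
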